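import Summits.Ventures.Crystal3D.Theorems.StickyWulffConstantCoaxialWallLawEndRowDefs
import HarnessLib

/-!
# Definitions: the two SEAM MOTIFS of the reader lattice graph (LBR″) — the Σ9 twin-reader pair and the tetrahedra fan
# (crux `CoaxialWallLaw`, stmt-Ventures-19481; cf-p1 RULING (ccxv)(A) «motif list as a def»)

HONEST FRAMING. Venture `Summits/Ventures/Crystal3D` (cell `crystal3d-full`); DEFINITIONS for the crux `CoaxialWallLaw` (stmt-Ventures-19481,
`route-Ventures-StickyWulffConstant`), lane F 'Certificates' v5, open stub `stub_seamResidual` (T5b).  Nothing is claimed; F-C1 not moved.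
WHY (cf-p1 (ccxv)(A), 19481-p1 g17 findings #1–#3, memo HOME/wall-19481-p1/g17/SIGMA9-READER-PAIR-g17.md): the reader-local rigidity of record is the READER
LATTICE GRAPH — adjacent FULL/TWIN readers share a lattice (`movedFcc_eq_of_isFull_adjacent`, `movedFcc_eq_or_twin_of_isFull_isTwinReading_adjacent`,
`movedFcc_eq_of_isTwinReading_adjacent`), so the readers at a payer form a connected Σ3-graph of lattices, which is ONE MODULE unless it contains one of two
motifs.  This file NAMES them (exact tables: calc/twintwin.py — of the 192 (bond, shared lattice, second normal) cases for two adjacent twin readers, 24 are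
co-axial and exactly 6 = the pair below up to symmetry; calc/fan_code.py for the fan):
* `Sigma9TwinPairOwn X q₁ q₂` — two adjacent TWIN readers with a COMMON own frame `G`, twin normals at `⟪m₁, m₂⟫ = −1/3`, each reader in the other's NEGATIVE
  triple (`q₂ = q₁ + G w`, `⟪G w, m₁⟫ < 0 < ⟪G w, m₂⟫`): the Σ9 second-generation junction at minimal scale (twin planes `(111) ∋ q₁`, `(1,−1,−1) ∋ q₂`);
* `Sigma9TwinPairMirror X q₁ q₂` — the same geometry seen from the other presentation of `q₁`: `q₂` in `q₁`'s MIRROR triple, `q₂`'s own frame the mirror frame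
  `G ∘ R`, `⟪m₁, m₂⟫ = +1/3` (`IsTwinReading` is not symmetric under exchanging own/mirror — the far-slot emptiness refers to the own frame — so both forms are kept);
* `Sigma9TwinPair X q₁ q₂` — either form;
* `TetraFanAt X z p t₁ t₂ t₃ t₄` — THREE face-sharing unit tetrahedra `{z,p,t₁,t₂}, {z,p,t₂,t₃}, {z,p,t₃,t₄}` around the edge `zp` (the NARROW-reader analogue:
  narrow readers certify only a regular tetrahedron, and this fan makes their lattices Σ3/Σ9-related while touching `z`);
* `TwinTwinDichotomy` — the exhaustiveness statement «adjacent twin readers: same axis (`m₂ = ±m₁`) or a Σ9 twin pair (either order)» as a named `Prop`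
  (the 192-case table; kernel proof = integer reading model, pending).
WHAT THIS IS NOT: no deficiency / pool statement about the motifs (that is the packing-optimisation input of `stub_seamResidual`); F-C1 not moved.
-/

noncomputable section

namespace Summit.Ventures.Crystal3D.Theorems

namespace TailResidue

open Summit.Ventures.Crystal3D Finset
open scoped InnerProductSpace

/-- **Σ9 TWIN-READER PAIR, own form**: adjacent twin readers `q₁`, `q₂ = q₁ + G w` with a common own frame `G`, normals at `⟪m₁, m₂⟫ = −1/3`, the bond `G w` in
`q₁`'s negative triple and `−G w` in `q₂`'s negative triple. -/
def Sigma9TwinPairOwn (X : Finset (EuclideanSpace ℝ (Fin 3))) (q₁ q₂ : EuclideanSpace ℝ (Fin 3)) : Prop :=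
  ∃ (G : EuclideanSpace ℝ (Fin 3) ≃ₗᵢ[ℝ] EuclideanSpace ℝ (Fin 3)) (m₁ m₂ w : EuclideanSpace ℝ (Fin 3)),
    IsTwinReading X G m₁ q₁ ∧ IsTwinReading X G m₂ q₂ ∧ ⟪m₁, m₂⟫_ℝ = -1 / 3 ∧
      w ∈ fccSlots ∧ ⟪G w, m₁⟫_ℝ < 0 ∧ 0 < ⟪G w, m₂⟫_ℝ ∧ q₂ = q₁ + G w

/-- **Σ9 TWIN-READER PAIR, mirror form**: `q₂` sits in `q₁`'s MIRROR triple (`q₂ = q₁ + R_{m₁}(G w)`, `⟪G w, m₁⟫ < 0`), `q₂`'s own frame is the mirror frame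
`G ∘ R_{m₁}`, the normals meet at `⟪m₁, m₂⟫ = +1/3`, and `q₁` is in `q₂`'s negative triple. -/
def Sigma9TwinPairMirror (X : Finset (EuclideanSpace ℝ (Fin 3))) (q₁ q₂ : EuclideanSpace ℝ (Fin 3)) : Prop :=
  ∃ (G : EuclideanSpace ℝ (Fin 3) ≃ₗᵢ[ℝ] EuclideanSpace ℝ (Fin 3)) (m₁ m₂ w : EuclideanSpace ℝ (Fin 3)),
    IsTwinReading X G m₁ q₁ ∧ IsTwinReading X (G.trans (ℝ ∙ m₁)ᗮ.reflection) m₂ q₂ ∧ ⟪m₁, m₂⟫_ℝ = 1 / 3 ∧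
      w ∈ fccSlots ∧ ⟪G w, m₁⟫_ℝ < 0 ∧ 0 < ⟪G w - (2 * ⟪G w, m₁⟫_ℝ) • m₁, m₂⟫_ℝ ∧
      q₂ = q₁ + (G w - (2 * ⟪G w, m₁⟫_ℝ) • m₁)

/-- **Σ9 TWIN-READER PAIR** (either presentation). -/
def Sigma9TwinPair (X : Finset (EuclideanSpace ℝ (Fin 3))) (q₁ q₂ : EuclideanSpace ℝ (Fin 3)) : Prop :=
  Sigma9TwinPairOwn X q₁ q₂ ∨ Sigma9TwinPairMirror X q₁ q₂

/-- **TETRAHEDRA FAN**: three face-sharing unit tetrahedra `{z,p,t₁,t₂}`, `{z,p,t₂,t₃}`, `{z,p,t₃,t₄}` of balls of `X` around the edge `zp` (seven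
distinct balls; all listed pairs at distance `1`). -/
def TetraFanAt (X : Finset (EuclideanSpace ℝ (Fin 3))) (z p t₁ t₂ t₃ t₄ : EuclideanSpace ℝ (Fin 3)) : Prop :=
  z ∈ X ∧ p ∈ X ∧ t₁ ∈ X ∧ t₂ ∈ X ∧ t₃ ∈ X ∧ t₄ ∈ X ∧ t₁ ≠ t₃ ∧ t₂ ≠ t₄ ∧ t₁ ≠ t₄ ∧
    dist z p = 1 ∧ dist z t₁ = 1 ∧ dist z t₂ = 1 ∧ dist z t₃ = 1 ∧ dist z t₄ = 1 ∧
    dist p t₁ = 1 ∧ dist p t₂ = 1 ∧ dist p t₃ = 1 ∧ dist p t₄ = 1 ∧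
    dist t₁ t₂ = 1 ∧ dist t₂ t₃ = 1 ∧ dist t₃ t₄ = 1

/-- **TWIN–TWIN DICHOTOMY** (named statement; exact table calc/twintwin.py, kernel proof pending): in a `1`-separated configuration two ADJACENT twin readers
have the same twin axis (`m₂ = ±m₁`: with the shared lattice this is the co-module case) or form a Σ9 twin pair in one of the two orders. -/
def TwinTwinDichotomy : Prop :=
  ∀ X : Finset (EuclideanSpace ℝ (Fin 3)), (∀ p ∈ X, ∀ q ∈ X, p ≠ q → 1 ≤ dist p q) →
    ∀ (G₁ G₂ : EuclideanSpace ℝ (Fin 3) ≃ₗᵢ[ℝ] EuclideanSpace ℝ (Fin 3)) (m₁ m₂ q₁ q₂ : EuclideanSpace ℝ (Fin 3)),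
      q₁ ∈ X → q₂ ∈ X → IsTwinReading X G₁ m₁ q₁ → IsTwinReading X G₂ m₂ q₂ → dist q₁ q₂ = 1 →
        (m₂ = m₁ ∨ m₂ = -m₁) ∨ Sigma9TwinPair X q₁ q₂ ∨ Sigma9TwinPair X q₂ q₁

/-- The own form is symmetric in the two readers. -/
theorem sigma9TwinPairOwn_symm {X : Finset (EuclideanSpace ℝ (Fin 3))} {q₁ q₂ : EuclideanSpace ℝ (Fin 3)}
    (h : Sigma9TwinPairOwn X q₁ q₂) : Sigma9TwinPairOwn X q₂ q₁ := by
  obtain ⟨G, m₁, m₂, w, h₁, h₂, hmm, hw, hneg, hpos, hq⟩ := h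
  refine ⟨G, m₂, m₁, -w, h₂, h₁, by rw [real_inner_comm]; exact hmm, neg_mem_fccSlots hw, ?_, ?_, ?_⟩
  · rw [map_neg, inner_neg_left]; linarith
  · rw [map_neg, inner_neg_left]; linarith
  · rw [hq, map_neg]; abel

end TailResidue

end Summit.Ventures.Crystal3D.Theorems

end
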